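/- Copyright: the b2b-balaban cell (near-miss cell 7), T⁴-continuum fan-out; row NE7b ROUND-2 swarm, seat
t4-ne7b-formalise-leaf-06 (gen 8) (road W-RP, sub-row «W-LAB», file 11b: THE PLAQUETTE SMALL-FIELD READER — the column
read through the tree's own plaquette predicate `PlaqSmallOn`; `read_meas` and `read_sym` are THEOREMS; INTENT journal
l.19807).  Released under the licence of the surrounding project. -/
import Summits.QuantumFields.BalabanUV.T4Continuum.Support.HistoryChessboardPlaquetteBox
import Summits.QuantumFields.BalabanUV.T4Continuum.Support.HistoryChessboardReaderCells
import Summits.QuantumFields.BalabanUV.T4Continuum.Support.HistoryChessboardGibbsCellsTemplates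

/-!
# Road W-RP, sub-row «W-LAB», file 11b: THE PLAQUETTE SMALL-FIELD READER — per cutoff only (U1)×(G2) remains

Summits-side support leaf of the T⁴-continuum cell (rung (B)+1 on a FINITE torus only; NOT infinite volume, NOT the
mass gap, NOT the Clay statement; NOT a proof of the spine estimate NE7b).  Row NE7b, road **W-RP** (R-OWNER-23-2 ∕
R-OWNER-23-8), sub-row «W-LAB», file 11b: the PLAQUETTE twin of file 10 (`HistoryChessboardSmallFieldReader`, which read
the reference cube column through BOND variables `U(b) ∈ A`).  Here the column is read through PLAQUETTE variables in
the TREE's own small-field predicate `Setup.PlaqSmallOn S δ U := ∀ p ∈ S, dist1 (U(∂p)) < δ` (the `[cite]`-tagged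
definition of B12 (0.18) ∕ B14 (1.4), imported — not restated), on top of file 11a (`HistoryChessboardPlaquetteBox`:
`boxPlaqs`, `measurableSet_plaqSmallOn_boxAlg`, `preimage_creflect_plaqSmallOn`), W3o files 1∕3
(`HistoryRPTowerTemplates`: `towerBox`, `measurable_fst∕snd_towerBox`; `HistoryRPTowerUniform`: `axisVec`,
`scale_axisVec`, `sitesPerDir_eq_mul_pow`), this sub-row's reader shapes (file 8 `ReaderCellSide`, file 6
`GibbsReaderPattern`) and W-2T file 3 (`pow_le_sitesPerDir`).  [folklore] bookkeeping of the symmetry ∕ measurability of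
OUR tower carrier; DATA defs `plaqUniform`, `plaqReader` (Boolean, by classical `decide`); no `structure`, no `[cite:]`
tag, no `Prop`-valued FACT minted (c1), no constant of print (c2∕c6), no exit ∕ socket ∕ `HistoryConstants` file touched
(c3); nothing of W3o ∕ W-2T ∕ files 1–11a restated.  The comparison with file 10's bond reader is file 11c
(`HistoryChessboardPlaquetteReaderBonds`).

WHY.  Files 6∕8 display, per cutoff, FOUR clauses on an arbitrary cube reader `f`: `read_meas`, `read_sym`, `univ_le`,
`r ≥ 0`; file 10 discharged the first two for the bond reader.  For the NATURAL PLAQUETTE reader of Bałaban-type small-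
field conditions — the Boolean «at every level `k' ≤ K` the field of level `k'` is `PlaqSmallOn` (tolerance `δ k'`,
level-dependent as in B12 (1.2) ∕ B15 (1.3)) on the box plaquettes of the cube's column» — the first two are again
THEOREMS, by file 11a's one-level lemmas carried down the tower exactly as W3o-3 did for bonds.  So for that reader the
per-cutoff display of road W is ONE inequality: `univ_le` = «under the Gibbs tower the event that EVERY cube's column
contains a plaquette violating `PlaqSmallOn` has probability ≤ r^(N^4)» ((U1)×(G2) in ratio currency), plus `r ≥ 0`.

WHAT.
* §3 the tower template `plaqUniform P G δ K M k`, **`measurableSet_plaqUniform`** (`towerBox`),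
  `preimage_towerRefl_plaqUniform` (every level), **`plaqUniform_sym`** (top cube of side `M ≤ N_K`, mirror cube
  `−M·e_i`).
* §4 the reader `plaqReader F δ m₁ K` (fibres `plaqReader_preimage_true∕false`), **`plaqReader_read_meas`**,
  **`plaqReader_read_sym`**, **`readerCellSide_plaqReader`** ∕ **`readerPattern_plaqReader`** from `0 ≤ r` + the ONE
  inequality; hence `cellSide_plaqReader` (W-2T's `CellSide`) and `side_plaqReader` (W7's `GibbsCubeSide os`) BY NAME.

HONEST SCOPE (R-OWNER-23-8 wording for road W-RP).  For the plaquette reader the event-geometry displays of road W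
((LOC), (R-sym), the (EXT) structural clauses) are theorems; what a cutoff displays is (U1)×(G2) for THIS reader and,
per string, NE7c∕NE7 on the DEFINED pattern weights (file 7) or W-2T's aggregate small-field sandwich; and the READING
that Bałaban's large-field classes per cube ARE «some plaquette of the cube's column violates `PlaqSmallOn`» with HIS
tolerances ((EXT) proper: in print the terms carry 𝐑-operations, analytic continuations and conditions on the averaged
and background fields of every level, not bare characteristic functions).  Nothing of H3 ∕ (B) ∕ BetaPertH ∕ (U1) ∕
(G2) ∕ NE7c ∕ NE7 discharged; no headline touched; 0∕9 unchanged.  NE7b NOT proved; spine 0∕9.  HONEST DEPENDENCY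
(cell): continuum YM on T⁴ ⇐ BetaPertH ∧ nine spine estimates (0/9 proved); BetaPertH ⇐ (D1) ∧ (D4) ∧ CAP+tail; G-an2-4
gates asym, D1 and NE2/3/4.  This file changes none of it.
-/

open Finset MeasureTheory Literature.Barriers.CriticalPhenomena.NonGibbs
open Literature.MathematicalPhysics.QuantumFieldTheory
open Literature.MathematicalPhysics.QuantumFieldTheory.Balaban1983to89
open Literature.MathematicalPhysics.QuantumFieldTheory.Balaban1983to89.Missing
open Literature.MathematicalPhysics.QuantumFieldTheory.Balaban1983to89.T4Continuum
open T4UndoubledRP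
open Summit.QuantumFields.BalabanUV.T4Continuum HistoryRPHalfTorus HistoryRPTowerLaw HistoryRPTowerCuts
open HistoryRPTowerCells HistoryRPTowerTemplates HistoryRPTowerColumns HistoryRPTowerUniform
open HistoryChessboardEventsSplit HistoryChessboardEventsTower HistoryChessboardEventsCubes
open HistoryChessboardEventsTemplates HistoryChessboardTowerRepr HistoryChessboardGibbsSide HistoryChessboardLabels
open HistoryChessboardLabelsReader HistoryChessboardLabelsGibbsReader HistoryChessboardLabelsPattern
open HistoryChessboardGibbsCells HistoryChessboardReaderCells HistoryChessboardGibbsCellsTemplates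
open HistoryChessboardPlaquetteBox

namespace Summit.QuantumFields.BalabanUV.T4Continuum.HistoryChessboardPlaquetteReader

noncomputable section

variable {P : Params} {G : Type*}

/-! ## §3 The plaquette template on the tower: reference-column measurability and reflection symmetry -/

section TowerTemplate

variable (P G) [GaugeGroup G]

/-- **THE PLAQUETTE SMALL-FIELD TEMPLATE OF THE REFERENCE COLUMN**: at every level `k' ≤ k` the field of level `k'` is
`PlaqSmallOn` (tolerance `δ k'`) on the box plaquettes of side `M·L^{K−k'}` (recursion as `towerBox`; level-dependent
tolerances as in B12 (1.2) ∕ B15 (1.3), a constant `δ` the special case). -/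
def plaqUniform (δ : ℕ → ℝ) (K M : ℕ) : (k : ℕ) → Set (Tower P G k)
  | 0 => {U | PlaqSmallOn (↑(boxPlaqs P 0 (M * P.L ^ (K - 0)))) (δ 0) U}
  | k + 1 => {ω | ω.1 ∈ plaqUniform δ K M k ∧
      PlaqSmallOn (↑(boxPlaqs P (k + 1) (M * P.L ^ (K - (k + 1))))) (δ (k + 1)) ω.2}

variable {P G}

/-- **`tmpl_meas` FOR THE PLAQUETTE TEMPLATE** (`RegularGaugeGroup`). [folklore] -/
theorem measurableSet_plaqUniform [MeasurableSpace G] [RegularGaugeGroup G] (δ : ℕ → ℝ) (K M : ℕ) :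
    ∀ k : ℕ, MeasurableSet[towerBox (P := P) G K M k] (plaqUniform P G δ K M k)
  | 0 => by
    show MeasurableSet[boxAlg G 0 (M * P.L ^ (K - 0))]
      {U : GaugeField P 0 G | PlaqSmallOn (↑(boxPlaqs P 0 (M * P.L ^ (K - 0)))) (δ 0) U}
    exact measurableSet_plaqSmallOn_boxAlg 0 _ (δ 0)
  | k + 1 => by
    have h1 : MeasurableSet[towerBox G K M (k + 1)] {ω : Tower P G (k + 1) | ω.1 ∈ plaqUniform P G δ K M k} :=
      (measurable_fst_towerBox K M k) (measurableSet_plaqUniform δ K M k)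
    have h2 : MeasurableSet[towerBox G K M (k + 1)] {ω : Tower P G (k + 1) |
        PlaqSmallOn (↑(boxPlaqs P (k + 1) (M * P.L ^ (K - (k + 1))))) (δ (k + 1)) ω.2} :=
      (measurable_snd_towerBox K M k) (measurableSet_plaqSmallOn_boxAlg (k + 1) _ (δ (k + 1)))
    show MeasurableSet[towerBox G K M (k + 1)] ({ω : Tower P G (k + 1) | ω.1 ∈ plaqUniform P G δ K M k} ∩
      {ω : Tower P G (k + 1) | PlaqSmallOn (↑(boxPlaqs P (k + 1) (M * P.L ^ (K - (k + 1))))) (δ (k + 1)) ω.2})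
    exact h1.inter h2

/-- **`tmpl_sym` FOR THE PLAQUETTE TEMPLATE** (every level `k ≤ K`; mirror vector `−M·L^{K−k}·e_i` at level `k`; the
top cube inside the torus: `M ≤ N_K`). [folklore] -/
theorem preimage_towerRefl_plaqUniform (δ : ℕ → ℝ) (i : Fin P.d) (K M : ℕ) (hM : M ≤ P.sitesPerDir K)
    (hK : K ≤ P.m + P.K) :
    ∀ k : ℕ, k ≤ K → (towerRefl i k) ⁻¹' plaqUniform P G δ K M k =
      (towerTranslate k (-axisVec P k i (M * P.L ^ (K - k)))) ⁻¹' plaqUniform P G δ K M k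
  | 0, hk => preimage_creflect_plaqSmallOn i (by
      rw [sitesPerDir_eq_mul_pow hk hK]; exact Nat.mul_le_mul_right _ hM) (δ 0)
  | k + 1, hk => by
    have hs : M * P.L ^ (K - (k + 1)) ≤ P.sitesPerDir (k + 1) := by
      rw [sitesPerDir_eq_mul_pow hk hK]; exact Nat.mul_le_mul_right _ hM
    have ih := preimage_towerRefl_plaqUniform δ i K M hM hK k (Nat.le_of_succ_le hk)
    have h1 := preimage_creflect_plaqSmallOn (P := P) (G := G) i hs (δ (k + 1))
    ext ω
    obtain ⟨ω', V⟩ := ω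
    have e1 := Set.ext_iff.1 ih ω'
    have e2 := Set.ext_iff.1 h1 V
    simp only [Set.mem_preimage, Set.mem_setOf_eq] at e1 e2
    have hsc : Site.scale (-axisVec P (k + 1) i (M * P.L ^ (K - (k + 1)))) = -axisVec P k i (M * P.L ^ (K - k)) := by
      rw [map_neg, scale_axisVec, mul_assoc, ← pow_succ, show K - (k + 1) + 1 = K - k by omega]
    show (towerRefl i k ω' ∈ plaqUniform P G δ K M k ∧
        PlaqSmallOn (↑(boxPlaqs P (k + 1) (M * P.L ^ (K - (k + 1))))) (δ (k + 1)) (GaugeField.creflect i V)) ↔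
      (towerTranslate k (Site.scale (-axisVec P (k + 1) i (M * P.L ^ (K - (k + 1))))) ω' ∈ plaqUniform P G δ K M k ∧
        PlaqSmallOn (↑(boxPlaqs P (k + 1) (M * P.L ^ (K - (k + 1))))) (δ (k + 1))
          (GaugeField.translate (-axisVec P (k + 1) i (M * P.L ^ (K - (k + 1)))) V))
    rw [hsc]
    exact and_congr e1 e2

/-- **AT THE TOP**: the plaquette template of a tower of height `K ≤ m + P.K` has the reflection symmetry of every axis
with mirror vector `−M·e_i` (the mirror CUBE; `M ≤ N_K`). [folklore] -/
theorem plaqUniform_sym (δ : ℕ → ℝ) {K M : ℕ} (hM : M ≤ P.sitesPerDir K) (hK : K ≤ P.m + P.K) (i : Fin P.d) :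
    (towerRefl i K) ⁻¹' plaqUniform P G δ K M K =
      (towerTranslate K (-axisVec P K i M)) ⁻¹' plaqUniform P G δ K M K := by
  have h := preimage_towerRefl_plaqUniform (P := P) (G := G) δ i K M hM hK K le_rfl
  rwa [Nat.sub_self, pow_zero, mul_one] at h

end TowerTemplate

/-! ## §4 The plaquette reader: `read_meas` ∕ `read_sym` theorems; per cutoff only (U1)×(G2) remains -/

section Reader

open Classical in
/-- **THE PLAQUETTE SMALL-FIELD READER** of the reference cube column (cubes of side `L^{m₁}`): `true` iff at EVERY
level `k' ≤ K` the field is `PlaqSmallOn` (tolerance `δ k'`) on the box plaquettes under the top cube at the origin;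
`false` = «some plaquette of the column has `dist1 (U(∂p)) ≥ δ`» — the BAD label. -/
def plaqReader (F : T4Family) [GaugeGroup G] (δ : ℕ → ℝ) (m₁ K : ℕ) : Tower (F.P K) G K → Bool :=
  fun ω => decide (ω ∈ plaqUniform (F.P K) G δ K (F.L ^ m₁) K)

variable {F : T4Family} [GaugeGroup G] {δ : ℕ → ℝ} {m₁ K : ℕ}

/-- the reader reads `true` exactly on the plaquette template. [folklore] -/
theorem plaqReader_eq_true_iff (ω : Tower (F.P K) G K) :
    plaqReader F δ m₁ K ω = true ↔ ω ∈ plaqUniform (F.P K) G δ K (F.L ^ m₁) K := by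
  simp [plaqReader]

/-- the `true`-fibre IS the plaquette template. [folklore] -/
theorem plaqReader_preimage_true : plaqReader F δ m₁ K ⁻¹' {true} = plaqUniform (F.P K) G δ K (F.L ^ m₁) K :=
  Set.ext fun ω => by simp [plaqReader]

/-- the `false`-fibre («a large plaquette somewhere in the column») is the complement. [folklore] -/
theorem plaqReader_preimage_false : plaqReader F δ m₁ K ⁻¹' {false} = (plaqUniform (F.P K) G δ K (F.L ^ m₁) K)ᶜ :=
  Set.ext fun ω => by simp [plaqReader]

/-- **`read_meas` IS A THEOREM for the plaquette reader**: every fibre is an event of the reference cube column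
`towerBox G K (L^{m₁}) K` (§3's `measurableSet_plaqUniform` and its complement). [folklore] -/
theorem plaqReader_read_meas [MeasurableSpace G] [RegularGaugeGroup G] :
    ∀ l, MeasurableSet[towerBox G K (F.L ^ m₁) K] (plaqReader F δ m₁ K ⁻¹' {l})
  | true => by
    rw [plaqReader_preimage_true]
    exact measurableSet_plaqUniform δ K _ K
  | false => by
    rw [plaqReader_preimage_false]
    exact (measurableSet_plaqUniform δ K _ K).compl

/-- **`read_sym` IS A THEOREM for the plaquette reader**: pointwise, reading the reflected tower = reading the tower
carried to the mirror cube (§3's `plaqUniform_sym`; side conditions `pow_le_sitesPerDir` of W-2T file 3 and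
`K ≤ m + K`). [folklore] -/
theorem plaqReader_read_sym (hm₁ : m₁ ≤ F.m) :
    ∀ (i : Fin 4) (ω : Tower (F.P K) G K),
      plaqReader F δ m₁ K (towerRefl i K ω) =
        plaqReader F δ m₁ K (towerTranslate K (-axisVec (F.P K) K i (F.L ^ m₁)) ω) := by
  intro i ω
  have h := Set.ext_iff.1 (plaqUniform_sym (P := F.P K) (G := G) δ (pow_le_sitesPerDir hm₁ K)
    (Nat.le_add_left K F.m) i) ω
  simp only [Set.mem_preimage] at h
  by_cases hω : towerRefl i K ω ∈ plaqUniform (F.P K) G δ K (F.L ^ m₁) K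
  · rw [(plaqReader_eq_true_iff _).2 hω, (plaqReader_eq_true_iff _).2 (h.1 hω)]
  · rw [Bool.eq_false_iff.2 (mt (plaqReader_eq_true_iff _).1 hω),
      Bool.eq_false_iff.2 (mt (plaqReader_eq_true_iff _).1 (mt h.2 hω))]

variable [MeasurableSpace G] [RegularGaugeGroup G] [HaarData G] {D : FiniteEpsData F G} {g₀ : ℕ → ℝ}
  {hm₁ : m₁ ≤ F.m} {r : ℝ}

/-- **FOR THE PLAQUETTE READER, ROAD W DISPLAYS ONE INEQUALITY PER CUTOFF**: file 8's `ReaderCellSide` (hence W-2T's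
five-clause `CellSide`, W7's two-term readings) with bad label `false` from `0 ≤ r` and the (U1)×(G2) inequality «under
the Gibbs tower, EVERY cube's column contains a plaquette violating `PlaqSmallOn` with probability ≤ r^(N^4)» ALONE —
`read_meas` and `read_sym` being the theorems above. [folklore] -/
theorem readerCellSide_plaqReader (hr : 0 ≤ r)
    (huniv : (gibbsTower D g₀ K).real
      {ω | ∀ c : BlockIdx 4 (cubeCount F m₁),
        plaqReader F δ m₁ K (towerTranslate K (cubeCorner (sitesPerDir_top_eq F hm₁ K) c) ω) = false} ≤
      r ^ (cubeCount F m₁ ^ 4)) :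
    ReaderCellSide D g₀ hm₁ K ({false} : Finset Bool) (plaqReader F δ m₁ K) r where
  read_meas l _ := plaqReader_read_meas l
  read_sym := plaqReader_read_sym hm₁
  univ_le l hl := by
    rw [Finset.mem_singleton] at hl
    subst hl
    exact huniv
  r_nonneg := hr

/-- … and file 6's `GibbsReaderPattern` (canonical pattern terms ⇒ file 7's reader witness fields `patA`∕`patB`) from
the SAME two hypotheses. [folklore] -/
theorem readerPattern_plaqReader (hr : 0 ≤ r)
    (huniv : (gibbsTower D g₀ K).real
      {ω | ∀ c : BlockIdx 4 (cubeCount F m₁),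
        plaqReader F δ m₁ K (towerTranslate K (cubeCorner (sitesPerDir_top_eq F hm₁ K) c) ω) = false} ≤
      r ^ (cubeCount F m₁ ^ 4)) :
    GibbsReaderPattern D g₀ hm₁ K ({false} : Finset Bool) (plaqReader F δ m₁ K) r where
  read_meas := plaqReader_read_meas
  read_sym := plaqReader_read_sym hm₁
  univ_le l hl := by
    rw [Finset.mem_singleton] at hl
    subst hl
    exact huniv
  r_nonneg := hr

/-- … hence W-2T's five-clause `CellSide` for the large-field cells «some plaquette of the cube's column violates
`PlaqSmallOn`», from the one inequality (file 8's `ReaderCellSide.cellSide`). [folklore] -/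
theorem cellSide_plaqReader (hr : 0 ≤ r)
    (huniv : (gibbsTower D g₀ K).real
      {ω | ∀ c : BlockIdx 4 (cubeCount F m₁),
        plaqReader F δ m₁ K (towerTranslate K (cubeCorner (sitesPerDir_top_eq F hm₁ K) c) ω) = false} ≤
      r ^ (cubeCount F m₁ ^ 4)) :
    CellSide D g₀ hm₁ K ({false} : Finset Bool)
      (fun l c => {ω | plaqReader F δ m₁ K (towerTranslate K (cubeCorner (sitesPerDir_top_eq F hm₁ K) c) ω) = l}) r :=
  (readerCellSide_plaqReader hr huniv).cellSide

/-- … and, for EVERY loop string, W7's eleven-clause side with CANONICAL PATTERN TERMS and DEFINED weights, from the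
one inequality (file 6's `GibbsReaderPattern.side`). [folklore] -/
theorem side_plaqReader (hr : 0 ≤ r)
    (huniv : (gibbsTower D g₀ K).real
      {ω | ∀ c : BlockIdx 4 (cubeCount F m₁),
        plaqReader F δ m₁ K (towerTranslate K (cubeCorner (sitesPerDir_top_eq F hm₁ K) c) ω) = false} ≤
      r ^ (cubeCount F m₁ ^ 4)) (os : List (ULoop F)) :
    GibbsCubeSide D g₀ os hm₁ K ({false} : Finset Bool) (Finset.univ : Finset (BlockIdx 4 (cubeCount F m₁) → Bool))
      (weight D g₀ os K fun p =>
        (fun ω c => plaqReader F δ m₁ K (towerTranslate K (cubeCorner (sitesPerDir_top_eq F hm₁ K) c) ω)) ⁻¹' {p})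
      (badPatterns {false})
      (fun p =>
        (fun ω c => plaqReader F δ m₁ K (towerTranslate K (cubeCorner (sitesPerDir_top_eq F hm₁ K) c) ω)) ⁻¹' {p})
      (fun l c => {ω | plaqReader F δ m₁ K (towerTranslate K (cubeCorner (sitesPerDir_top_eq F hm₁ K) c) ω) = l}) r :=
  (readerPattern_plaqReader hr huniv).side os

/-- Sanity (node test of the SHAPE on the real tower, as W-2T file 3's): with rate `r = 1` the plaquette reader's
cell side holds at every cutoff of every run — `univ_le` by `μ.real ≤ 1` for the probability measure `gibbsTower`
(W7's `isProbabilityMeasure_gibbsTower`); `read_meas` ∕ `read_sym` are the theorems above; only a smaller `r` carries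
content ((U1)×(G2)). -/
example (hM : D.AvgMeasurable) : ReaderCellSide D g₀ hm₁ K ({false} : Finset Bool) (plaqReader F δ m₁ K) 1 :=
  haveI := isProbabilityMeasure_gibbsTower D hM g₀ K
  readerCellSide_plaqReader zero_le_one (by
    rw [one_pow]
    exact (measureReal_mono (Set.subset_univ _) (measure_ne_top _ _)).trans_eq (by simp))

end Reader

end

end Summit.QuantumFields.BalabanUV.T4Continuum.HistoryChessboardPlaquetteReader
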